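import Summits.QuantumFields.YangMills.Theorems.BalabanUVNodesN15NeumannCubeOutputRows
import HarnessLib

/-!
# Route «BalabanUVNodes» (K3⁷), node N15 = NE2, -a lane, PROGRAMME N file N-IIi: THE BARE CUBE PROPAGATOR BEHIND ANY EXPONENTIALLY DECAYING OPERATOR — the images kernel survives
# one row-sum convolution, and behind an output cut the mirror images are farther: `χ_□ ∘ T₁ ∘ G(□ + c) ≤ 1_□1_□·2^{d+1}a₁Ce^{δ₀}c_r·e^{−ρd}` (dag-n15-c's `M_h∘N_L∘G(□)` term)

Cell `pub-ymgap`, seat `pub-ymgap-dag-n15-a` (KNIT-BY-NAME, g19; D-0062; chair R424 venue; `bears_on: R4∕N15`); `--kind proof --supports stmt-QuantumFields-20544 --as helper`.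
Sequel of N-IIf `…N15NeumannCubeOutputRows` (the images kernel (β′)).  Inputs BY NAME: [B11] §G `hasMaj_comp`, `conv_exp_le`, `RowSum` (Literature `B11SectG`), [B6] `Triangle254`; N-IIf
`hasMaj_reflSet_comp_images`; N-IIIb `tdistT_le_tdistT_reflBlk`, `exists_val_reflected_eq`, `hasMaj_comp_mulOp_chiInt`.  CONSUMER: dag-n15-c FILE 56∕63 — the nonlocal commutator
`[N_L, M_h]∘G(□) = N_L∘M_h∘G(□) − M_h∘N_L∘G(□)`: the first half reads the two-sided cut row (N-IIIb), the second half is THIS file with `T₁ := N_L` (their `hasMaj_landauRe` letter) and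
`M_h = M_h∘M_{χ_□}`.

WHAT.  §24 `tdistT_eq_of_coord_eq`, ★ `tdistT_reflBlk_comm` (`|reflBlk_T y − y′|_T = |y − reflBlk_T y′|_T`), ★ `hasMaj_mulOp_chiCube_comp` (output localization by the block cut),
★★★ `hasMaj_comp_neumannCubeG_images` (`T₁ ≤ a₁e^{−ρ₁d}` two-sided + `G ≤ Ce^{−δ₀d}` + row sum `c_r` at rate `σ`, `ρ ≤ δ₀`, `ρ + σ ≤ ρ₁` ⟹
`T₁ ∘ G(□ + c) ≤ 1_□(y′)·a₁Ce^{δ₀}c_r·Σ_T e^{−ρ|y − reflBlk_T y′|_T}`), ★★★ `hasMaj_chiCube_comp_neumannCubeG` (doubled-cube torus `M_ν = 2S`: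
`χ_□ ∘ T₁ ∘ G(□ + c) ≤ 1_□(y)1_□(y′)·2^{d+1}a₁Ce^{δ₀}c_r·e^{−ρ|y−y′|_T}`).
HONEST FRAMING.  Block-majorant bookkeeping ([B6]∕[B11] random-walk letters BY NAME, row sum and triangle inequality taken as hypotheses as in dag-n15-c's files); no new analytic estimate;
`U ≡ 1` torus MODEL on the doubled-cube family (one-cube model — ref-B OBSERVATION-2∕CAUTION-P (4)); nothing of [B6]∕[B9] asserted; N15 NOT discharged (object-bound; NE2⁺ NOT PRINTED); counts
UNMOVED (typed 28∕28 · discharged 5∕27); one finite torus — NOT continuum ∕ ℝ⁴ ∕ OS ∕ mass gap ∕ Clay.  Theorems only (0 `def`).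
-/

noncomputable section

open scoped BigOperators Matrix
open Finset

namespace Summit.QuantumFields.YangMills.BalabanUVNodes.N15.TwoGrid

open Literature.MathematicalPhysics.QuantumFieldTheory.Balaban1983to89
open Literature.MathematicalPhysics.QuantumFieldTheory.Balaban1983to89.B5Prop11Plancherel (Tor fine unitVec)
open Literature.MathematicalPhysics.QuantumFieldTheory.Balaban1983to89.B5Block118 (up bpt)
open Literature.MathematicalPhysics.QuantumFieldTheory.Balaban1983to89.B6Prop26Gluing (mulOp mulOp_apply ind ind_nonneg ind_le_one)
open Literature.MathematicalPhysics.QuantumFieldTheory.King1986.Torus (blockOf tdistT tdistT_symm tdistT_self tdistT_triangle tdistT_nonneg toSite)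
open Literature.MathematicalPhysics.QuantumFieldTheory.Balaban1983to89.B11SectG (BlockNorm HasMaj)
open Literature.MathematicalPhysics.QuantumFieldTheory.Balaban1983to89.B6UnitTorusCarrier (unitTorusGeo)
open Literature.MathematicalPhysics.QuantumFieldTheory.Balaban1983to89.B5SiteBridgeP12 (MP)
open Summit.QuantumFields.YangMills.BalabanUVNodes.N15.VectorPiece (blkFine)

variable {d : ℕ}

/-! ## §24 THE BARE CUBE PROPAGATOR BEHIND ANY EXPONENTIALLY DECAYING OPERATOR: images are moved to the far argument (`|reflBlk_T y − y′| = |y − reflBlk_T y′|`), one row-sum convolution,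
and the output cut makes mirror images farther — dag-n15-c's `M_h∘N_L∘N_□` half of `[N_L, M_h]∘N_□` -/

section Convolution

open Literature.MathematicalPhysics.QuantumFieldTheory.Balaban1983to89.B11AxialTransport190 (abs_le_loc_ofBlocks loc_ofBlocks_le)
open Literature.MathematicalPhysics.QuantumFieldTheory.Balaban1983to89.B4TorusKernel.MultiPeriod (circAbs circAbs_add_mul)
open Literature.MathematicalPhysics.QuantumFieldTheory.Balaban1983to89.B4Sect5Torus (ccoord tdist circAbs_neg)
open Literature.MathematicalPhysics.QuantumFieldTheory.Balaban1983to89.B6RandomWalk (Triangle254)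
open Literature.MathematicalPhysics.QuantumFieldTheory.Balaban1983to89.B11SectG (RowSum hasMaj_comp conv_exp_le)

variable {L : ℕ} {M : Fin (d + 1) → ℕ} [∀ μ, NeZero (M μ)] {k n : ℕ} [NeZero n] {c : Tor M} {S : ℕ}

/-- `|·|_T` depends on the coordinate circular distances only. [folklore] -/
theorem tdistT_eq_of_coord_eq {y₁ z₁ y₂ z₂ : Tor M} (h : ∀ ν, circAbs (M ν) (((y₁ ν).val : ℤ) - (z₁ ν).val) = circAbs (M ν) (((y₂ ν).val : ℤ) - (z₂ ν).val)) :
    tdistT M y₁ z₁ = tdistT M y₂ z₂ := by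
  unfold tdistT tdist
  have hs : Finset.univ.sup (ccoord M (toSite M y₁) (toSite M z₁)) = Finset.univ.sup (ccoord M (toSite M y₂) (toSite M z₂)) := by
    congr 1; funext ν; rw [ccoord_toSite, ccoord_toSite, h ν]
  rw [hs]

/-- ★ **THE BLOCK IMAGES MOVE BETWEEN THE ARGUMENTS OF THE TORUS DISTANCE**: `|reflBlk_T y − y′|_T = |y − reflBlk_T y′|_T` (each face reflection is an involutive isometry). [folklore] -/
theorem tdistT_reflBlk_comm (T : Finset (Fin (d + 1))) (y y' : Tor M) : tdistT M (reflBlk M c T y) y' = tdistT M y (reflBlk M c T y') := by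
  refine tdistT_eq_of_coord_eq fun ν => ?_
  by_cases hν : ν ∈ T
  · have h1 : reflBlk M c T y ν = 2 * c ν - 1 - y ν := by simp [reflBlk, hν]
    have h2 : reflBlk M c T y' ν = 2 * c ν - 1 - y' ν := by simp [reflBlk, hν]
    obtain ⟨k₁, hk₁⟩ := exists_val_reflected_eq (c ν) (y ν)
    obtain ⟨k₂, hk₂⟩ := exists_val_reflected_eq (c ν) (y' ν)
    rw [h1, h2, hk₁, hk₂]
    have hN : 1 ≤ M ν := Nat.one_le_iff_ne_zero.mpr (NeZero.ne (M ν))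
    rw [show ((y ν).val : ℤ) - (2 * ((c ν).val : ℤ) - 1 - (y' ν).val + (M ν : ℤ) * k₂) =
        -(2 * ((c ν).val : ℤ) - 1 - (y ν).val + (M ν : ℤ) * k₁ - (y' ν).val) + (M ν : ℤ) * (k₁ - k₂) by ring, circAbs_add_mul, circAbs_neg hN]
  · rw [reflBlk_apply_of_not_mem hν, reflBlk_apply_of_not_mem hν]

/-- ★ OUTPUT LOCALIZATION BY THE BLOCK CUT: `M_{χ_□} ∘ T` has the majorant of `T` times `1_□(y)`. [folklore] -/
theorem hasMaj_mulOp_chiCube_comp {F₁ : Type} [AddCommGroup F₁] [Module ℝ F₁] {b₁ : BlockNorm (unitTorusGeo L k M) F₁} {T : F₁ →ₗ[ℝ] (Tor (fine n M) × Fin (d + 1) → ℝ)}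
    {K : Tor M → Tor M → ℝ} (hK : ∀ y y', 0 ≤ K y y')
    (h : HasMaj b₁ (BlockNorm.ofBlocks (unitTorusGeo L k M) (fun b : Tor (fine n M) × Fin (d + 1) => blockOf n M b.1)) T K) :
    HasMaj b₁ (BlockNorm.ofBlocks (unitTorusGeo L k M) (fun b : Tor (fine n M) × Fin (d + 1) => blockOf n M b.1)) (mulOp (chiCube M n c S) ∘ₗ T)
      (fun y y' => ind (cubeBlocks M c S : Set (Tor M)) y * K y y') := by
  classical
  intro y' μ hμ y
  dsimp only
  set blk := fun b : Tor (fine n M) × Fin (d + 1) => blockOf n M b.1 with hblk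
  by_cases hy : y ∈ cubeBlocks M c S
  · have hi : ind (cubeBlocks M c S : Set (Tor M)) y = 1 := by simp [ind, hy]
    rw [hi, one_mul]
    exact hasMaj_mulOp_comp_of_abs_le_one _ (abs_chiCube_le_one S) hK h y' μ hμ y
  · have hi : ind (cubeBlocks M c S : Set (Tor M)) y = 0 := by simp [ind, hy]
    rw [hi, zero_mul, zero_mul]
    refine loc_ofBlocks_le (g := unitTorusGeo L k M) blk _ le_rfl fun b hb => ?_
    rw [LinearMap.comp_apply, mulOp_apply, chiCube_of_not_mem (by rw [show blockOf n M b.1 = y from hb]; exact hy), zero_mul, abs_zero]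

/-- ★★★ **THE BARE NEUMANN CUBE PROPAGATOR BEHIND AN EXPONENTIALLY DECAYING OPERATOR** (no output cut yet): if `T₁ ≤ a₁e^{−ρ₁d}` (two-sided, unlocalized) and `G ≤ Ce^{−δ₀d}` on the torus, then
`T₁ ∘ G(□ + c) ≤ 1_□(y′)·κa₁Ce^{δ₀}c_r·Σ_T e^{−ρ|y − reflBlk_T y′|_T}` — the images kernel survives one convolution (row sum `c_r` at rate `σ`, `ρ ≤ δ₀`, `ρ + σ ≤ ρ₁`).
[cite: Balaban1984PropagatorsII, (2.37) p.229 (images), Lemma 2.1 (2.61)–(2.62) p.234 (row sums); Balaban1984PropagatorsI, Prop. 1.2 (1.110) p.35] -/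
theorem hasMaj_comp_neumannCubeG_images {F₃ : Type} [AddCommGroup F₃] [Module ℝ F₃] {b₃ : BlockNorm (unitTorusGeo L k M) F₃}
    {T₁ : (Tor (fine n M) × Fin (d + 1) → ℝ) →ₗ[ℝ] F₃} {a C a₁ δ₀ ρ₁ ρ σ cr : ℝ}
    (htri : Triangle254 (unitTorusGeo L k M)) (hrow : RowSum (unitTorusGeo L k M) σ cr) (hC : 0 ≤ C) (hδ₀ : 0 ≤ δ₀) (ha₁ : 0 ≤ a₁) (hρ : 0 ≤ ρ) (hρδ : ρ ≤ δ₀) (hρσ : ρ + σ ≤ ρ₁)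
    (h₁ : HasMaj (BlockNorm.ofBlocks (unitTorusGeo L k M) (fun b : Tor (fine n M) × Fin (d + 1) => blockOf n M b.1)) b₃ T₁ (fun y y' => a₁ * Real.exp (-(ρ₁ * tdistT M y y'))))
    (hG : HasMaj (BlockNorm.ofBlocks (unitTorusGeo L k M) (fun b : Tor (fine n M) × Fin (d + 1) => blockOf n M b.1))
      (BlockNorm.ofBlocks (unitTorusGeo L k M) (fun b : Tor (fine n M) × Fin (d + 1) => blockOf n M b.1)) (gOp M n a) (fun y y' => C * Real.exp (-(δ₀ * tdistT M y y')))) :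
    HasMaj (BlockNorm.ofBlocks (unitTorusGeo L k M) (fun b : Tor (fine n M) × Fin (d + 1) => blockOf n M b.1)) b₃ (T₁ ∘ₗ neumannCubeG M n c S a)
      (fun y y' => ind (cubeBlocks M c S : Set (Tor M)) y' *
        (a₁ * (C * Real.exp δ₀) * cr * ∑ T ∈ (Finset.univ : Finset (Fin (d + 1))).powerset, Real.exp (-(ρ * tdistT M y (reflBlk M c T y'))))) := by
  have hd : ∀ a b : (unitTorusGeo L k M).Site, 0 ≤ (unitTorusGeo L k M).dist a b := fun a b => tdistT_nonneg M a b
  have hX := hasMaj_comp_mulOp_chiInt (c := c) (S := S) hC hG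
  -- per image: `R_T ∘ G ∘ χ°` with the image moved to the source argument, then one convolution
  have hT : ∀ T : Finset (Fin (d + 1)), HasMaj (BlockNorm.ofBlocks (unitTorusGeo L k M) (fun b : Tor (fine n M) × Fin (d + 1) => blockOf n M b.1)) b₃
      (T₁ ∘ₗ (reflSet M n c T ∘ₗ (gOp M n a ∘ₗ mulOp (chiInt M n c S))))
      (fun y y' => ind (cubeBlocks M c S : Set (Tor M)) y' * (a₁ * (C * Real.exp δ₀) * cr * Real.exp (-(ρ * tdistT M y (reflBlk M c T y'))))) := by
    intro T
    have h₂ := (hasMaj_reflSet_comp_images (c := c) (fun _ => ind_nonneg _ _) hC hδ₀ T hX).mono (K' := fun z y' =>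
        ind (cubeBlocks M c S : Set (Tor M)) y' * (C * Real.exp δ₀ * Real.exp (-(δ₀ * tdistT M z (reflBlk M c T y'))))) fun z y' => by
      rw [tdistT_reflBlk_comm]
    refine (hasMaj_comp h₁ h₂ fun y y' => mul_nonneg ha₁ (Real.exp_nonneg _)).mono fun y y' => ?_
    dsimp only
    have hκ : (BlockNorm.ofBlocks (unitTorusGeo L k M) (fun b : Tor (fine n M) × Fin (d + 1) => blockOf n M b.1)).κ = 1 := rfl
    have hconv := conv_exp_le htri hd hrow hρ hρδ hρσ y (reflBlk M c T y')
    calc ∑ z : Tor M, a₁ * Real.exp (-(ρ₁ * tdistT M y z)) *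
          ((BlockNorm.ofBlocks (unitTorusGeo L k M) (fun b : Tor (fine n M) × Fin (d + 1) => blockOf n M b.1)).κ *
            (ind (cubeBlocks M c S : Set (Tor M)) y' * (C * Real.exp δ₀ * Real.exp (-(δ₀ * tdistT M z (reflBlk M c T y'))))))
        = ind (cubeBlocks M c S : Set (Tor M)) y' * (a₁ * (C * Real.exp δ₀)) *
            ∑ z : Tor M, Real.exp (-(ρ₁ * tdistT M y z)) * Real.exp (-(δ₀ * tdistT M z (reflBlk M c T y'))) := by
          rw [hκ, Finset.mul_sum]; exact Finset.sum_congr rfl fun z _ => by ring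
      _ ≤ ind (cubeBlocks M c S : Set (Tor M)) y' * (a₁ * (C * Real.exp δ₀)) * (cr * Real.exp (-(ρ * tdistT M y (reflBlk M c T y')))) :=
          mul_le_mul_of_nonneg_left hconv (mul_nonneg (ind_nonneg _ _) (by positivity))
      _ = _ := by ring
  have hsplit : T₁ ∘ₗ neumannCubeG M n c S a = ∑ T ∈ (Finset.univ : Finset (Fin (d + 1))).powerset, T₁ ∘ₗ (reflSet M n c T ∘ₗ (gOp M n a ∘ₗ mulOp (chiInt M n c S))) := by
    rw [neumannCubeG, symOp, fsum_comp, comp_fsum]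
  rw [hsplit]
  refine (hasMaj_finsum _ _ _ fun T _ => hT T).mono fun y y' => le_of_eq ?_
  rw [Finset.mul_sum, Finset.mul_sum]

/-- ★★★ **… AND BEHIND AN OUTPUT CUT THE IMAGES ARE FARTHER**: `χ_□ ∘ T₁ ∘ G(□ + c) ≤ 1_□(y)1_□(y′)·2^{d+1}κa₁Ce^{δ₀}c_r·e^{−ρ|y−y′|_T}` on the doubled-cube torus (`M_ν = 2S`) — dag-n15-c's
`M_h∘N_L∘G(□)` term with `T₁ = N_L` (the nonlocal Landau part) and `M_h = M_h∘M_{χ_□}`. [cite: Balaban1984PropagatorsII, (2.37) p.229, (2.133)–(2.134) p.247 (shapes); Balaban1984PropagatorsI, (1.126)–(1.128) p.38] -/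
theorem hasMaj_chiCube_comp_neumannCubeG {T₁ : (Tor (fine n M) × Fin (d + 1) → ℝ) →ₗ[ℝ] (Tor (fine n M) × Fin (d + 1) → ℝ)} {a C a₁ δ₀ ρ₁ ρ σ cr : ℝ} (hM : ∀ ν, M ν = 2 * S)
    (htri : Triangle254 (unitTorusGeo L k M)) (hrow : RowSum (unitTorusGeo L k M) σ cr) (hC : 0 ≤ C) (hδ₀ : 0 ≤ δ₀) (ha₁ : 0 ≤ a₁) (hρ : 0 ≤ ρ) (hρδ : ρ ≤ δ₀) (hρσ : ρ + σ ≤ ρ₁)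
    (h₁ : HasMaj (BlockNorm.ofBlocks (unitTorusGeo L k M) (fun b : Tor (fine n M) × Fin (d + 1) => blockOf n M b.1))
      (BlockNorm.ofBlocks (unitTorusGeo L k M) (fun b : Tor (fine n M) × Fin (d + 1) => blockOf n M b.1)) T₁ (fun y y' => a₁ * Real.exp (-(ρ₁ * tdistT M y y'))))
    (hG : HasMaj (BlockNorm.ofBlocks (unitTorusGeo L k M) (fun b : Tor (fine n M) × Fin (d + 1) => blockOf n M b.1))
      (BlockNorm.ofBlocks (unitTorusGeo L k M) (fun b : Tor (fine n M) × Fin (d + 1) => blockOf n M b.1)) (gOp M n a) (fun y y' => C * Real.exp (-(δ₀ * tdistT M y y')))) :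
    HasMaj (BlockNorm.ofBlocks (unitTorusGeo L k M) (fun b : Tor (fine n M) × Fin (d + 1) => blockOf n M b.1))
      (BlockNorm.ofBlocks (unitTorusGeo L k M) (fun b : Tor (fine n M) × Fin (d + 1) => blockOf n M b.1)) (mulOp (chiCube M n c S) ∘ₗ T₁ ∘ₗ neumannCubeG M n c S a)
      (fun y y' => ind (cubeBlocks M c S : Set (Tor M)) y * ind (cubeBlocks M c S : Set (Tor M)) y' *
        (2 ^ (d + 1) * (a₁ * (C * Real.exp δ₀) * cr) * Real.exp (-(ρ * tdistT M y y')))) := by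
  have hcr : 0 ≤ cr := hrow.nonneg (c : Tor M)
  have h := hasMaj_mulOp_chiCube_comp (c := c) (S := S) (fun y y' => mul_nonneg (ind_nonneg _ _) (mul_nonneg (by positivity)
    (Finset.sum_nonneg fun _ _ => Real.exp_nonneg _))) (hasMaj_comp_neumannCubeG_images (c := c) (S := S) htri hrow hC hδ₀ ha₁ hρ hρδ hρσ h₁ hG)
  refine h.mono fun y y' => ?_
  by_cases hy : y ∈ cubeBlocks M c S
  · by_cases hy' : y' ∈ cubeBlocks M c S
    · have hi : ind (cubeBlocks M c S : Set (Tor M)) y = 1 := by simp [ind, hy]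
      have hi' : ind (cubeBlocks M c S : Set (Tor M)) y' = 1 := by simp [ind, hy']
      have hA0 : 0 ≤ a₁ * (C * Real.exp δ₀) * cr := by positivity
      have hsumT : ∑ T ∈ (Finset.univ : Finset (Fin (d + 1))).powerset, Real.exp (-(ρ * tdistT M y (reflBlk M c T y'))) ≤
          2 ^ (d + 1) * Real.exp (-(ρ * tdistT M y y')) :=
        calc ∑ T ∈ (Finset.univ : Finset (Fin (d + 1))).powerset, Real.exp (-(ρ * tdistT M y (reflBlk M c T y')))
            ≤ ∑ T ∈ (Finset.univ : Finset (Fin (d + 1))).powerset, Real.exp (-(ρ * tdistT M y y')) :=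
              Finset.sum_le_sum fun T _ => Real.exp_le_exp.mpr (by
                have := tdistT_le_tdistT_reflBlk (c := c) hM hy' hy T
                rw [tdistT_symm M y' y, tdistT_symm M (reflBlk M c T y') y] at this
                nlinarith)
          _ = 2 ^ (d + 1) * Real.exp (-(ρ * tdistT M y y')) := by
              rw [Finset.sum_const, Finset.card_powerset, Finset.card_univ, Fintype.card_fin, nsmul_eq_mul]; push_cast; ring
      simp only [hi, hi', one_mul]
      calc a₁ * (C * Real.exp δ₀) * cr * ∑ T ∈ (Finset.univ : Finset (Fin (d + 1))).powerset, Real.exp (-(ρ * tdistT M y (reflBlk M c T y')))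
          ≤ a₁ * (C * Real.exp δ₀) * cr * (2 ^ (d + 1) * Real.exp (-(ρ * tdistT M y y'))) := mul_le_mul_of_nonneg_left hsumT hA0
        _ = 2 ^ (d + 1) * (a₁ * (C * Real.exp δ₀) * cr) * Real.exp (-(ρ * tdistT M y y')) := by ring
    · have hi' : ind (cubeBlocks M c S : Set (Tor M)) y' = 0 := by simp [ind, hy']
      rw [hi']; simp
  · have hi : ind (cubeBlocks M c S : Set (Tor M)) y = 0 := by simp [ind, hy]
    rw [hi]; simp

end Convolution

end Summit.QuantumFields.YangMills.BalabanUVNodes.N15.TwoGrid
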